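import Summits.ValiantsHypothesis.ValiantsHypothesis.Theorems.DetQPDetqpThesisRankHardnessCalibration
import Summits.ValiantsHypothesis.ValiantsHypothesis.Theorems.DetQPDetqpThesisChowRankDegreeFloor

/-!
# `DetqpThesis` (stmt-ValiantsHypothesis-0315), line `chow-rank-ladder` — calibration of the bet,
# part B: uniform Bombieri-tightness ⇒ the bet; the bet ⇒ the fixed-rank rungs; price list

Companion of `DetQPDetqpThesisRankHardnessCalibration.lean` (part A: the bet puts `dc (per)` in
the exponential regime; its weakest load-bearing reshape is `⇔ X`).  Here:

* §B1 `rankHardness_of_uniformBombieriTight`: if the Bombieri/Barvinok width `C(n+r-1, r-1)` of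
  the rank-`r` permanent is the truth up to ONE polynomial factor `n^k` uniformly in `r ≥ 2`,
  `n ≥ r²`, then the registered bet `stub_rankHardness` holds verbatim with
  `(p, q, A) = (1, 4k+8, 2)` — so the bet cannot be refuted short of beating that width by more
  than every polynomial factor (no construction known), and nothing here supports it either.
* §B2 the bet ⇒ `stub_polyRung` ⇒ `stub_kvRung` (the line's milestones, verbatim), re-derived from
  the crux-plan skeleton so that the chain is on the tree; and the assembled PRICE LIST
  `priceList_of_rankHardness`: bet ⇒ (kvRung ∧ X ∧ exponential regime).

All statements take the registered stub `stub_rankHardness` VERBATIM as a hypothesis; nothing is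
claimed about its truth.  Sources as in part A; A. Barvinok, Math. Oper. Res. 21 (1996).
-/

-- single-conjunct layout: Sub = Summit, duplicated namespace component intended
set_option linter.dupNamespace false

noncomputable section

namespace Summit.ValiantsHypothesis.ValiantsHypothesis.Theorems.DetQPDetqpThesis.RankHardnessCalibration

open MvPolynomial
open scoped BigOperators
open Literature.Computability.AlgebraicComplexity
open Summit.ValiantsHypothesis.Theorems.DetqpThesis.Negative
open Summit.ValiantsHypothesis.ValiantsHypothesis.Theorems.DetQPDetqpThesis

/-! ## §B1 The bet is "the Bombieri program is polynomially tight, uniformly in the rank" -/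

/-- **§3 — uniform Bombieri-tightness implies the bet.**  The Bombieri/Chow expansion
`per_n (U Vᵀ) = Σ_κ κ! · E_κ(U) E_κ(V)` (κ a composition of `n` into `r` parts) is an algebraic
branching program of width `C(n+r-1, r-1)` for `P n r` (Barvinok 1996: permanents of rank-`r`
matrices in `n^{O(r)}` operations).  IF that width is the truth up to a polynomial factor
UNIFORMLY in the rank — `C(n+r-1, r-1) ≤ n^k · dc (P n r)` for all `r ≥ 2`, `n ≥ r²`, one `k` —
then RANK-HARDNESS (the registered `stub_rankHardness`, verbatim) holds with
`(p, q, A) = (1, 4k + 8, 2)`: for `r ≤ 4k + 8` the degree floor `n ≤ 2n ≤ dc (P n r)`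
(`ChowRankDegreeFloor.two_mul_le_dc_rankPer`, landed) gives `n^r ≤ dc^{4k+8}`; for `r > 4k + 8`,
`n^{r-1} ≤ (r-1)! · C(n+r-1, r-1)` (`Nat.pow_sub_le_descFactorial`), `(r-1)! ≤ r^{r-1}`,
`r^{2(r-1)} ≤ n^{r-1}` (`n ≥ r²`) give `n^{r-1-2k} ≤ dc²`, and `(r-1-2k)(2k+4) ≥ r`.  So refuting
the bet means beating the Bombieri width by more than every polynomial factor somewhere in
`n ≥ r²` — an algorithmic statement about low-rank permanents for which no construction is known;
conversely nothing here is evidence FOR the bet. [folklore] -/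
theorem rankHardness_of_uniformBombieriTight :
    (∃ k : ℕ, ∀ r : ℕ, 2 ≤ r → ∀ n : ℕ, r ^ 2 ≤ n →
      Nat.choose (n + r - 1) (r - 1) ≤ n ^ k *
        determinantalComplexity (aeval (fun x : Fin n × Fin n => ∑ a : Fin r,
            (X (Sum.inl (x.1, a)) * X (Sum.inr (x.2, a)) :
              MvPolynomial ((Fin n × Fin r) ⊕ (Fin n × Fin r)) ℂ)) (perPoly (Fin n) ℂ))) →
    ∃ p q A : ℕ, 0 < p ∧ 0 < q ∧ 2 ≤ A ∧ ∀ r : ℕ, 1 ≤ r → ∀ n : ℕ, r ^ A ≤ n →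
      n ^ (p * r) ≤ determinantalComplexity (aeval (fun x : Fin n × Fin n => ∑ a : Fin r,
            (X (Sum.inl (x.1, a)) * X (Sum.inr (x.2, a)) :
              MvPolynomial ((Fin n × Fin r) ⊕ (Fin n × Fin r)) ℂ)) (perPoly (Fin n) ℂ)) ^ q := by
  rintro ⟨k, hB⟩
  refine ⟨1, 4 * k + 8, 2, one_pos, by omega, le_rfl, fun r hr n hn => ?_⟩
  rw [one_mul]
  set d := determinantalComplexity (aeval (fun x : Fin n × Fin n => ∑ a : Fin r,
        (X (Sum.inl (x.1, a)) * X (Sum.inr (x.2, a)) :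
          MvPolynomial ((Fin n × Fin r) ⊕ (Fin n × Fin r)) ℂ)) (perPoly (Fin n) ℂ)) with hd
  have hn1 : 1 ≤ n := le_trans (Nat.one_le_pow _ _ hr) hn
  have hn0 : 0 < n := hn1
  have hdeg : 2 * n ≤ d := ChowRankDegreeFloor.two_mul_le_dc_rankPer n r hr
  have hnd : n ≤ d := by omega
  by_cases hrq : r ≤ 4 * k + 8
  · -- small rank: the degree floor suffices
    calc n ^ r ≤ n ^ (4 * k + 8) := Nat.pow_le_pow_right hn1 hrq
      _ ≤ d ^ (4 * k + 8) := Nat.pow_le_pow_left hnd _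
  · have hr2 : 2 ≤ r := by omega
    have hC := hB r hr2 n hn
    -- `n^{r-1} ≤ (r-1)! · C(n+r-1, r-1)`
    have h1 : n ^ (r - 1) ≤ (r - 1).factorial * Nat.choose (n + r - 1) (r - 1) := by
      rw [← Nat.descFactorial_eq_factorial_mul_choose]
      calc n ^ (r - 1) ≤ (n + r - 1 + 1 - (r - 1)) ^ (r - 1) := Nat.pow_le_pow_left (by omega) _
        _ ≤ (n + r - 1).descFactorial (r - 1) := Nat.pow_sub_le_descFactorial _ _
    -- `(r-1)! ≤ r^{r-1}` and `(r^{r-1})² ≤ n^{r-1}`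
    have h2 : (r - 1).factorial ≤ r ^ (r - 1) :=
      (Nat.factorial_le_pow (r - 1)).trans (Nat.pow_le_pow_left (Nat.sub_le r 1) _)
    have h3 : (r ^ (r - 1)) ^ 2 ≤ n ^ (r - 1) := by
      rw [← pow_mul, mul_comm, pow_mul]
      exact Nat.pow_le_pow_left hn _
    -- square and cancel: `n^{r-1} ≤ (n^k · d)²`
    have h4 : n ^ (r - 1) * n ^ (r - 1) ≤ n ^ (r - 1) * (n ^ k * d) ^ 2 := by
      calc n ^ (r - 1) * n ^ (r - 1) = (n ^ (r - 1)) ^ 2 := (sq _).symm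
        _ ≤ ((r - 1).factorial * Nat.choose (n + r - 1) (r - 1)) ^ 2 := Nat.pow_le_pow_left h1 _
        _ = ((r - 1).factorial) ^ 2 * (Nat.choose (n + r - 1) (r - 1)) ^ 2 := mul_pow _ _ _
        _ ≤ (r ^ (r - 1)) ^ 2 * (n ^ k * d) ^ 2 :=
            Nat.mul_le_mul (Nat.pow_le_pow_left h2 _) (Nat.pow_le_pow_left hC _)
        _ ≤ n ^ (r - 1) * (n ^ k * d) ^ 2 := Nat.mul_le_mul_right _ h3
    have h5 : n ^ (r - 1) ≤ (n ^ k * d) ^ 2 := Nat.le_of_mul_le_mul_left h4 (pow_pos hn0 _)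
    -- cancel `n^{2k}`: `n^{r-1-2k} ≤ d²`
    have h6 : n ^ (r - 1 - 2 * k) ≤ d ^ 2 := by
      have e : n ^ (r - 1) = n ^ (2 * k) * n ^ (r - 1 - 2 * k) := by
        rw [← pow_add]; congr 1; omega
      have h' : n ^ (2 * k) * n ^ (r - 1 - 2 * k) ≤ n ^ (2 * k) * d ^ 2 := by
        calc n ^ (2 * k) * n ^ (r - 1 - 2 * k) = n ^ (r - 1) := e.symm
          _ ≤ (n ^ k * d) ^ 2 := h5
          _ = n ^ (2 * k) * d ^ 2 := by rw [mul_pow, ← pow_mul, mul_comm k 2]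
      exact Nat.le_of_mul_le_mul_left h' (pow_pos hn0 _)
    -- raise to the `(2k+4)`-th power
    have h7 : r ≤ (r - 1 - 2 * k) * (2 * k + 4) := by
      have h44 : 4 ≤ 2 * k + 4 := by omega
      calc r ≤ (r - 1 - 2 * k) * 4 := by omega
        _ ≤ (r - 1 - 2 * k) * (2 * k + 4) := Nat.mul_le_mul_left _ h44
    calc n ^ r ≤ n ^ ((r - 1 - 2 * k) * (2 * k + 4)) := Nat.pow_le_pow_right hn1 h7
      _ = (n ^ (r - 1 - 2 * k)) ^ (2 * k + 4) := pow_mul _ _ _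
      _ ≤ (d ^ 2) ^ (2 * k + 4) := Nat.pow_le_pow_left h6 _
      _ = d ^ (4 * k + 8) := by rw [← pow_mul]; ring_nf

/-! ## §B2 The milestones below the bet, and the price list -/

/-- **The milestones are consequences of the bet** (from the crux-plan skeleton, re-derived so
that the chain is on the tree): RANK-HARDNESS ⇒ the polynomial rung (registered `stub_polyRung`,
verbatim) with `r = 2q + 2`, `k = q`. [folklore] -/
theorem polyRung_of_rankHardness
    (hR : ∃ p q A : ℕ, 0 < p ∧ 0 < q ∧ 2 ≤ A ∧ ∀ r : ℕ, 1 ≤ r → ∀ n : ℕ, r ^ A ≤ n →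
      n ^ (p * r) ≤ determinantalComplexity (aeval (fun x : Fin n × Fin n => ∑ a : Fin r,
            (X (Sum.inl (x.1, a)) * X (Sum.inr (x.2, a)) :
              MvPolynomial ((Fin n × Fin r) ⊕ (Fin n × Fin r)) ℂ)) (perPoly (Fin n) ℂ)) ^ q) :
    ∃ r k n₀ : ℕ, 1 ≤ r ∧ 1 ≤ k ∧ ∀ n : ℕ, n₀ ≤ n → (2 * n * r) ^ (k + 1) ≤
      determinantalComplexity (aeval (fun x : Fin n × Fin n => ∑ a : Fin r,
          (X (Sum.inl (x.1, a)) * X (Sum.inr (x.2, a)) :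
            MvPolynomial ((Fin n × Fin r) ⊕ (Fin n × Fin r)) ℂ)) (perPoly (Fin n) ℂ)) ^ k := by
  obtain ⟨p, q, A, hp, hq, _hA, h⟩ := hR
  refine ⟨2 * q + 2, q, max ((2 * q + 2) ^ A) (2 * (2 * q + 2)), by omega, hq, fun n hn => ?_⟩
  have hnA : (2 * q + 2) ^ A ≤ n := le_trans (le_max_left _ _) hn
  have hn2 : 2 * (2 * q + 2) ≤ n := le_trans (le_max_right _ _) hn
  have hn1 : 1 ≤ n := by omega
  have key := h (2 * q + 2) (by omega) n hnA
  calc (2 * n * (2 * q + 2)) ^ (q + 1)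
      = (2 * (2 * q + 2)) ^ (q + 1) * n ^ (q + 1) := by rw [← mul_pow]; ring_nf
    _ ≤ n ^ (q + 1) * n ^ (q + 1) := Nat.mul_le_mul_right _ (Nat.pow_le_pow_left hn2 _)
    _ = n ^ (1 * (2 * q + 2)) := by rw [← pow_add]; ring_nf
    _ ≤ n ^ (p * (2 * q + 2)) := Nat.pow_le_pow_right hn1 (Nat.mul_le_mul_right _ hp)
    _ ≤ _ := key

/-- … ⇒ the Kumar–Volk rung (registered `stub_kvRung`, verbatim) with the same `r` and factor
`2`: from `(2nr)^{k+1} ≤ dc^k` and `2^k ≤ 2nr`, `2 · 2nr ≤ dc`. [folklore] -/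
theorem kvRung_of_polyRung
    (h : ∃ r k n₀ : ℕ, 1 ≤ r ∧ 1 ≤ k ∧ ∀ n : ℕ, n₀ ≤ n → (2 * n * r) ^ (k + 1) ≤
      determinantalComplexity (aeval (fun x : Fin n × Fin n => ∑ a : Fin r,
          (X (Sum.inl (x.1, a)) * X (Sum.inr (x.2, a)) :
            MvPolynomial ((Fin n × Fin r) ⊕ (Fin n × Fin r)) ℂ)) (perPoly (Fin n) ℂ)) ^ k) :
    ∃ r k n₀ : ℕ, 1 ≤ r ∧ 1 ≤ k ∧ ∀ n : ℕ, n₀ ≤ n → (k + 1) * (2 * n * r) ≤ k *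
      determinantalComplexity (aeval (fun x : Fin n × Fin n => ∑ a : Fin r,
          (X (Sum.inl (x.1, a)) * X (Sum.inr (x.2, a)) :
            MvPolynomial ((Fin n × Fin r) ⊕ (Fin n × Fin r)) ℂ)) (perPoly (Fin n) ℂ)) := by
  obtain ⟨r, k, n₀, hr, hk, h⟩ := h
  refine ⟨r, 1, max n₀ (2 ^ k), hr, le_rfl, fun n hn => ?_⟩
  have hn₀ : n₀ ≤ n := le_trans (le_max_left _ _) hn
  have hnk : 2 ^ k ≤ n := le_trans (le_max_right _ _) hn
  have key := h n hn₀
  set N := 2 * n * r with hN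
  set d := determinantalComplexity (aeval (fun x : Fin n × Fin n => ∑ a : Fin r,
        (X (Sum.inl (x.1, a)) * X (Sum.inr (x.2, a)) :
          MvPolynomial ((Fin n × Fin r) ⊕ (Fin n × Fin r)) ℂ)) (perPoly (Fin n) ℂ)) with hd
  have hNk : 2 ^ k ≤ N := by
    calc 2 ^ k ≤ n := hnk
      _ ≤ 2 * n * r := by nlinarith
  have h1 : (2 * N) ^ k ≤ d ^ k := by
    calc (2 * N) ^ k = 2 ^ k * N ^ k := by rw [mul_pow]
      _ ≤ N * N ^ k := Nat.mul_le_mul_right _ hNk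
      _ = N ^ (k + 1) := by rw [pow_succ]; ring
      _ ≤ d ^ k := key
  have h2 : 2 * N ≤ d := (Nat.pow_le_pow_iff_left (by omega)).1 h1
  simpa [one_mul] using h2

/-- **Price list of the line, assembled.**  The registered bet implies, in order: the
polynomial rung, the Kumar–Volk rung (both open, the latter a theorem-candidate of
Kumar–Volk-record type), the crux `X` (skeleton `DetqpThesis_of`), and the exponential regime
`2^r ≤ dc (per_N)` (`N ≥ r^A`, `r ≥ r₀`) — while its weakest load-bearing reshape is `⇔ X`.
This conjunction is the calibration the lead's verdict cites. [folklore] -/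
theorem priceList_of_rankHardness
    (hR : ∃ p q A : ℕ, 0 < p ∧ 0 < q ∧ 2 ≤ A ∧ ∀ r : ℕ, 1 ≤ r → ∀ n : ℕ, r ^ A ≤ n →
      n ^ (p * r) ≤ determinantalComplexity (aeval (fun x : Fin n × Fin n => ∑ a : Fin r,
            (X (Sum.inl (x.1, a)) * X (Sum.inr (x.2, a)) :
              MvPolynomial ((Fin n × Fin r) ⊕ (Fin n × Fin r)) ℂ)) (perPoly (Fin n) ℂ)) ^ q) :
    (∃ r k n₀ : ℕ, 1 ≤ r ∧ 1 ≤ k ∧ ∀ n : ℕ, n₀ ≤ n → (k + 1) * (2 * n * r) ≤ k *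
      determinantalComplexity (aeval (fun x : Fin n × Fin n => ∑ a : Fin r,
          (X (Sum.inl (x.1, a)) * X (Sum.inr (x.2, a)) :
            MvPolynomial ((Fin n × Fin r) ⊕ (Fin n × Fin r)) ℂ)) (perPoly (Fin n) ℂ))) ∧
    Summit.ValiantsHypothesis.ValiantsHypothesis.Theses.DetQP.DetqpThesis ∧
    (∃ A : ℕ, 2 ≤ A ∧ ∃ r₀ : ℕ, ∀ r : ℕ, r₀ ≤ r → ∀ N : ℕ, r ^ A ≤ N →
      2 ^ r ≤ determinantalComplexity (perPoly (Fin N) ℂ)) := by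
  exact ⟨kvRung_of_polyRung (polyRung_of_rankHardness hR), detqpThesis_of_rankHardness hR,
    exp_regime_of_rankHardness hR⟩

end Summit.ValiantsHypothesis.ValiantsHypothesis.Theorems.DetQPDetqpThesis.RankHardnessCalibration

end
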